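import Literature.Analysis.FluidPDE.KatoLaiGradientPart
import Mathlib.Analysis.ODE.Gronwall
import HarnessLib

/-!
# Kato–Lai in the periodic cylinder: uniqueness of the cell velocity

Analysis/FluidPDE support file for the energy-method construction of Euler flows in the
periodic cylinder (`Literature.Analysis.FluidPDE.KatoLai1984_periodicCylinderUniformExistence`;
Kato–Lai 1984, §5, p. 23: "This solution is unique … it suffices to note that `dₜu ∈ C_w(I; H⁰)`
so that `u ∈ Lip(I; H⁰)`, and we have `dₜ‖u − v‖₀² = 2(u − v | dₜ(u − v))₀` for any two
solutions"). Two solutions in duality form (possibly at different levels `s` and parameters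
`ε`) whose cell velocity classes agree at `t = 0` and have vanishing gradient parts have the
same cell velocity class on `[0, T]`:

* `exists_integral_convect_sq_le_sup_right` — `∫ ‖(A·∇)B‖² ≤ C lat₀(A) lat₃(B)`;
* `abs_inner_cellOf_sub_klOp_sub_le` — the per-truncation estimate
  `|⟪δu, 𝒜u¹ − 𝒜u²⟫_{L²(cell)}| ≤ K √lat₃(U²) ‖δu‖² + ‖Q δu‖ ‖b¹ − b²‖`
  (transport by `Pu¹` is skew, Kato–Lai (4.10); the Leray projection is an `L²` contraction);
* `abs_inner_velCell_sub_le` — its limit `|⟪D, R 𝒜̂u¹ − R 𝒜̂u²⟫| ≤ K' ‖D‖²` when `Q D = 0`;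
* `velCell_eq_of_eq_zero` — **uniqueness** by Grönwall.

Everything is proved; no named fact and no `sorry` is introduced.

## References

* T. Kato, C. Y. Lai, J. Funct. Anal. 56 (1984) 15–28, §5 (p. 23). [KatoLai1984]
-/

noncomputable section

open MeasureTheory Set Function Filter Topology TopologicalSpace
open scoped NNReal ENNReal InnerProductSpace RealInnerProductSpace ContDiff

namespace Literature.Analysis.FluidPDE

open FunctionSpaces FunctionSpaces.Torus UnitAddTorus

/-- Local notation for physical space `ℝ³ = EuclideanSpace ℝ (Fin 3)`. -/
local notation "ℝ³" => EuclideanSpace ℝ (Fin 3)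

/-- Local notation for the closed cylinder `{r ≤ 1}`. -/
local notation "𝕂" => closure (SetLike.coe unitCylinder : Set (EuclideanSpace ℝ (Fin 3)))

namespace PeriodicCylinder

variable {L : ℝ} (hL : 0 < L)

/-! ### One more `L²` bound of a convective term -/

/-- **`∫ ‖(A·∇)B‖² ≤ C lat₀(A) lat₃(B)`** (sup on `∇B`). [folklore] -/
theorem exists_integral_convect_sq_le_sup_right : ∃ C : ℝ, 0 ≤ C ∧
    ∀ (A B : UnitAddTorus (Fin 3) → ℝ³), IsSmooth A → IsSmooth B →
      ∫ ξ, ‖Torus.convect A B ξ‖ ^ 2 ≤ C * Torus.latNormSq 0 A * Torus.latNormSq 3 B := by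
  obtain ⟨C, hC0, hC⟩ := Torus.exists_trilinear_sup_right (d := Fin 3) (by simp)
  refine ⟨C ^ 2, by positivity, fun A B hA hB => ?_⟩
  have hc := hA.convect hB
  have h := hC A B (Torus.convect A B) hA hB hc
  have h2 := integral_sq_le_of_self_pairing (by have := Torus.latNormSq_nonneg 0 A; positivity) h
  calc ∫ ξ, ‖Torus.convect A B ξ‖ ^ 2 ≤ (C * Real.sqrt (Torus.latNormSq 0 A) * Real.sqrt (Torus.latNormSq 3 B)) ^ 2 := h2
    _ = C ^ 2 * Torus.latNormSq 0 A * Torus.latNormSq 3 B := by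
        rw [mul_pow, mul_pow, Real.sq_sqrt (Torus.latNormSq_nonneg 0 A), Real.sq_sqrt (Torus.latNormSq_nonneg 3 B)]

/-! ### The per-truncation estimate -/

/-- `‖toCell f‖² = ∫_cell ‖f‖²` for `f` continuous on the closed cylinder. [folklore] -/
theorem norm_toCell_sq {F : Type*} [NormedAddCommGroup F] [NormedSpace ℝ F] {f : ℝ³ → F} (hf : ContinuousOn f 𝕂) :
    ‖toCell L f‖ ^ 2 = ∫ x in (cylinderCell L : Set ℝ³), ‖f x‖ ^ 2 := by
  rw [norm_toCell_eq_cellL2 hf, integral_norm_sq_eq_cellL2_sq L hf]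

/-- Cauchy–Schwarz on the cell through the classes: `|∫_cell ⟪f, g⟫| ≤ ‖toCell f‖ ‖toCell g‖`. [folklore] -/
theorem abs_setIntegral_inner_le_norm_toCell {f g : ℝ³ → ℝ³} (hf : ContinuousOn f 𝕂) (hg : ContinuousOn g 𝕂) :
    |∫ x in (cylinderCell L : Set ℝ³), ⟪f x, g x⟫_ℝ| ≤ ‖toCell L f‖ * ‖toCell L g‖ := by
  rw [← inner_toCell_toCell (memLp_two_cylinderCell_of_continuousOn L hf) (memLp_two_cylinderCell_of_continuousOn L hg)]
  exact abs_real_inner_le_norm _ _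

/-- **The per-truncation estimate** (Kato–Lai p. 23, "standard"): for smooth torus fields
`U¹, U²` with cell fields `uⁱ`, Leray parts `wⁱ`, convective terms `bⁱ = (wⁱ·∇_K)wⁱ`,
`δu = u¹ − u²`:
`|⟪cellOf U¹ − cellOf U², cellOf (klOp U¹) − cellOf (klOp U²)⟫| ≤ K √lat₃(U²) ‖δu‖² + ‖Q δu‖ ‖b¹ − b²‖`.
[cite: KatoLai1984, §5 (p. 23)] -/
theorem exists_abs_inner_cellOf_sub_klOp_sub_le : ∃ K : ℝ, 0 ≤ K ∧
    ∀ (U₁ U₂ : UnitAddTorus (Fin 3) → ℝ³) (h₁ : IsSmooth U₁) (h₂ : IsSmooth U₂),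
      |⟪cellOf L U₁ - cellOf L U₂, cellOf L (klOp L hL h₁) - cellOf L (klOp L hL h₂)⟫_ℝ| ≤
        K * Real.sqrt (Torus.latNormSq 3 U₂) * ‖cellOf L U₁ - cellOf L U₂‖ ^ 2 +
          ‖helmholtzProj L (cellOf L U₁ - cellOf L U₂)‖ *
            ‖toCell L (convTerm hL (isSmoothPeriodic_fromTorus hL.ne' h₁)) - toCell L (convTerm hL (isSmoothPeriodic_fromTorus hL.ne' h₂))‖ := by
  obtain ⟨Csr, hCsr0, hCsr⟩ := exists_integral_convect_sq_le_sup_right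
  obtain ⟨C0, hC00, hC0⟩ := exists_latNormSq_zero_torusRep_le hL
  obtain ⟨Cr3, hCr30, hCr3⟩ := exists_latNormSq_torusRep_le hL 3
  obtain ⟨CE3, hCE30, hCE3⟩ := exists_toReal_eSobolevDomainNorm_fromTorus_sq_le hL 3
  -- `∫_cell |(δw·∇)u²|² ≤ 16 L · Csr · (C0 ‖M‖² ‖δw‖²) · (Cr3 CE3 lat₃ U²)`
  refine ⟨Real.sqrt (16 * L * Csr * (C0 * ‖(boxInvLin L : ℝ³ →L[ℝ] ℝ³)‖ ^ 2) * (Cr3 * CE3)), by positivity, fun U₁ U₂ h₁ h₂ => ?_⟩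
  have hu₁ := isSmoothPeriodic_fromTorus hL.ne' h₁
  have hu₂ := isSmoothPeriodic_fromTorus hL.ne' h₂
  have hd : IsSmooth (fun ξ => U₁ ξ - U₂ ξ) := h₁.sub h₂
  have hud := isSmoothPeriodic_fromTorus hL.ne' hd
  have hw₁ := isSmoothPeriodic_lerayPart hL hu₁
  have hw₂ := isSmoothPeriodic_lerayPart hL hu₂
  have hb₁ := isSmoothPeriodic_convTerm hL hu₁
  have hb₂ := isSmoothPeriodic_convTerm hL hu₂
  have hπ₁ := isSmoothPeriodic_pressureGrad hL hu₁
  have hπ₂ := isSmoothPeriodic_pressureGrad hL hu₂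
  have hcell : (cylinderCell L : Set ℝ³) ⊆ 𝕂 := fun x hx => subset_closure (cylinderCell_le_unitCylinder L hx)
  -- names
  set δu : ℝ³ → ℝ³ := fun x => fromTorus L U₁ x - fromTorus L U₂ x with hδu
  have hδus : IsSmoothPeriodic L δu := hu₁.sub hu₂
  set δw : ℝ³ → ℝ³ := fun x => lerayPart hL hu₁ x - lerayPart hL hu₂ x with hδw
  have hδws : IsSmoothPeriodic L δw := hw₁.sub hw₂
  -- `cellOf U₁ − cellOf U₂ = toCell δu`
  have hX : cellOf L U₁ - cellOf L U₂ = toCell L δu := by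
    rw [cellOf, cellOf, ← toCell_sub hu₁.memLp hu₂.memLp]
  -- `cellOf (klOp Uᵢ) = toCell ((wᵢ·∇)uᵢ − ∇πᵢ)`
  have hA : ∀ {U : UnitAddTorus (Fin 3) → ℝ³} (hU : IsSmooth U),
      cellOf L (klOp L hL hU) = toCell L (fun x => cylDeriv (lerayPart hL (isSmoothPeriodic_fromTorus hL.ne' hU)) (fromTorus L U) x -
        pressureGrad hL (isSmoothPeriodic_fromTorus hL.ne' hU) x) := fun hU => by
    refine toCell_congr fun x hx => ?_
    have hxU : x ∈ (unitCylinder : Set ℝ³) := cylinderCell_le_unitCylinder L hx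
    rw [fromTorus_klOp_eq hL hU (subset_closure hxU), cylDeriv_eq_fderiv _ _ hxU]
  have hc₁ : IsSmoothPeriodic L (cylDeriv (lerayPart hL hu₁) (fromTorus L U₁)) := isSmoothPeriodic_cylDeriv hw₁ hu₁
  have hc₂ : IsSmoothPeriodic L (cylDeriv (lerayPart hL hu₂) (fromTorus L U₂)) := isSmoothPeriodic_cylDeriv hw₂ hu₂
  -- `toCell δw = P (toCell δu)`, hence `‖toCell δw‖ ≤ ‖toCell δu‖`
  have hδw_eq : toCell L δw = lerayProj L (toCell L δu) := by
    have hEq := lerayPart_eqOn_of_sub hL hu₁ hu₂ hud fun x => rfl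
    rw [show toCell L δw = toCell L (lerayPart hL hud) from toCell_congr fun x hx => (hEq hx).symm, ← lerayProj_eq_lerayPart hL hud]
    rfl
  have hδw_le : ‖toCell L δw‖ ≤ ‖toCell L δu‖ := by
    rw [hδw_eq, lerayProj_apply]; exact Submodule.norm_starProjection_apply_le _ _
  -- ### the transport term `(δw·∇) u²` in `L²(cell)`
  set A : UnitAddTorus (Fin 3) → ℝ³ := torusRep L fun y => boxInvLin L (δw y) with hAdef
  set B : UnitAddTorus (Fin 3) → ℝ³ := torusRep L (fromTorus L U₂) with hBdef
  have hMδw : IsSmoothPeriodic L fun y => boxInvLin L (δw y) :=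
    ⟨(boxInvLin L).contDiff.comp_contDiffOn hδws.smooth, fun x => by
      have hp : IsAxiallyPeriodic L δw := hδws.periodic
      show boxInvLin L (δw (x + _)) = _
      rw [hp x]⟩
  have hAs : IsSmooth A := isSmooth_torusRep hMδw
  have hBs : IsSmooth B := isSmooth_torusRep hu₂
  have hT2cell : toCell L (cylDeriv δw (fromTorus L U₂)) = cellOf L (Torus.convect A B) := by
    refine toCell_congr fun x hx => ?_
    exact cylDeriv_eq_fromTorus_convect hL hδws hu₂ (cylinderCell_le_unitCylinder L hx)
  have hT2norm : ‖toCell L (cylDeriv δw (fromTorus L U₂))‖ ^ 2 ≤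
      (16 * L * Csr * (C0 * ‖(boxInvLin L : ℝ³ →L[ℝ] ℝ³)‖ ^ 2) * (Cr3 * CE3)) * Torus.latNormSq 3 U₂ * ‖toCell L δu‖ ^ 2 := by
    rw [hT2cell, norm_cellOf_sq (hAs.convect hBs)]
    have h1 := integral_cylinderCell_fromTorus_sq_le hL (hAs.convect hBs)
    have h2 := hCsr A B hAs hBs
    -- `lat₀(A) ≤ C0 ‖M‖² ‖toCell δu‖²`
    have h3 : Torus.latNormSq 0 A ≤ C0 * ‖(boxInvLin L : ℝ³ →L[ℝ] ℝ³)‖ ^ 2 * ‖toCell L δu‖ ^ 2 := by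
      have h31 := hC0 _ hMδw
      have h32 : ∫ x in (cylinderCell L : Set ℝ³), ‖boxInvLin L (δw x)‖ ^ 2 ≤
          ‖(boxInvLin L : ℝ³ →L[ℝ] ℝ³)‖ ^ 2 * ∫ x in (cylinderCell L : Set ℝ³), ‖δw x‖ ^ 2 := by
        rw [← integral_const_mul]
        refine integral_mono_of_nonneg (ae_of_all _ fun x => sq_nonneg _)
          ((integrableOn_cylinderCell_of_continuousOn_K L (hδws.continuousOn.norm.pow 2)).const_mul _) (ae_of_all _ fun x => ?_)
        calc ‖boxInvLin L (δw x)‖ ^ 2 ≤ (‖(boxInvLin L : ℝ³ →L[ℝ] ℝ³)‖ * ‖δw x‖) ^ 2 :=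
              pow_le_pow_left₀ (norm_nonneg _) ((boxInvLin L).le_opNorm _) 2
          _ = _ := by ring
      have h33 : ∫ x in (cylinderCell L : Set ℝ³), ‖δw x‖ ^ 2 ≤ ‖toCell L δu‖ ^ 2 := by
        rw [← norm_toCell_sq hδws.continuousOn]
        exact pow_le_pow_left₀ (norm_nonneg _) hδw_le 2
      calc Torus.latNormSq 0 A ≤ C0 * ∫ x in (cylinderCell L : Set ℝ³), ‖boxInvLin L (δw x)‖ ^ 2 := h31
        _ ≤ C0 * (‖(boxInvLin L : ℝ³ →L[ℝ] ℝ³)‖ ^ 2 * ‖toCell L δu‖ ^ 2) :=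
            mul_le_mul_of_nonneg_left (h32.trans (mul_le_mul_of_nonneg_left h33 (sq_nonneg _))) hC00
        _ = _ := by ring
    -- `lat₃(B) ≤ Cr3 CE3 lat₃(U₂)`
    have h4 : Torus.latNormSq 3 B ≤ Cr3 * CE3 * Torus.latNormSq 3 U₂ := by
      calc Torus.latNormSq 3 B ≤ Cr3 * (eSobolevDomainNorm 3 2 (cylinderCell L) volume (fromTorus L U₂)).toReal ^ 2 := hCr3 _ hu₂
        _ ≤ Cr3 * (CE3 * Torus.latNormSq 3 U₂) := mul_le_mul_of_nonneg_left (hCE3 U₂ h₂) hCr30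
        _ = _ := by ring
    have l0 := Torus.latNormSq_nonneg 0 A
    have l3 := Torus.latNormSq_nonneg 3 U₂
    calc ∫ x in (cylinderCell L : Set ℝ³), ‖fromTorus L (Torus.convect A B) x‖ ^ 2
        ≤ 16 * L * ∫ ξ, ‖Torus.convect A B ξ‖ ^ 2 := h1
      _ ≤ 16 * L * (Csr * Torus.latNormSq 0 A * Torus.latNormSq 3 B) := mul_le_mul_of_nonneg_left h2 (by positivity)
      _ ≤ 16 * L * (Csr * (C0 * ‖(boxInvLin L : ℝ³ →L[ℝ] ℝ³)‖ ^ 2 * ‖toCell L δu‖ ^ 2) * (Cr3 * CE3 * Torus.latNormSq 3 U₂)) :=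
          mul_le_mul_of_nonneg_left (mul_le_mul (mul_le_mul_of_nonneg_left h3 hCsr0) h4 (Torus.latNormSq_nonneg 3 B) (by positivity))
            (by positivity)
      _ = _ := by ring
  set K : ℝ := Real.sqrt (16 * L * Csr * (C0 * ‖(boxInvLin L : ℝ³ →L[ℝ] ℝ³)‖ ^ 2) * (Cr3 * CE3)) with hKdef
  have hT2le : ‖toCell L (cylDeriv δw (fromTorus L U₂))‖ ≤ K * Real.sqrt (Torus.latNormSq 3 U₂) * ‖toCell L δu‖ := by
    have hrhs : (K * Real.sqrt (Torus.latNormSq 3 U₂) * ‖toCell L δu‖) ^ 2 =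
        (16 * L * Csr * (C0 * ‖(boxInvLin L : ℝ³ →L[ℝ] ℝ³)‖ ^ 2) * (Cr3 * CE3)) * Torus.latNormSq 3 U₂ * ‖toCell L δu‖ ^ 2 := by
      rw [mul_pow, mul_pow, hKdef, Real.sq_sqrt (by positivity), Real.sq_sqrt (Torus.latNormSq_nonneg 3 U₂)]
    have := hT2norm
    rw [← hrhs] at this
    exact (pow_le_pow_iff_left₀ (norm_nonneg _) (by positivity) two_ne_zero).1 this
  -- ### the pressure terms: `⟪toCell δu, toCell ∇π₁ − toCell ∇π₂⟫ = ⟪Q (toCell δu), toCell b₁ − toCell b₂⟫`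
  have hT3 : ⟪toCell L δu, toCell L (pressureGrad hL hu₁) - toCell L (pressureGrad hL hu₂)⟫_ℝ =
      ⟪helmholtzProj L (toCell L δu), toCell L (convTerm hL hu₁) - toCell L (convTerm hL hu₂)⟫_ℝ := by
    rw [show toCell L (pressureGrad hL hu₁) = helmholtzProj L (toCell L (convTerm hL hu₁)) from ((lerayPot_spec hL hb₁).2.1).symm,
      show toCell L (pressureGrad hL hu₂) = helmholtzProj L (toCell L (convTerm hL hu₂)) from ((lerayPot_spec hL hb₂).2.1).symm,
      ← map_sub, helmholtzProj_apply, helmholtzProj_apply, ← Submodule.inner_starProjection_left_eq_right]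
  -- ### the skew term
  have hT1 : ∫ x in (cylinderCell L : Set ℝ³), ⟪δu x, cylDeriv (lerayPart hL hu₁) δu x⟫_ℝ = 0 := by
    have h := setIntegral_inner_cylDeriv_self_eq_zero hL hw₁ hδus (divergence_lerayPart hL hu₁) (slip_lerayPart hL hu₁)
    rw [← h]
    exact setIntegral_congr_fun (cylinderCell L).isOpen.measurableSet fun x _ => real_inner_comm _ _
  -- ### assembly
  have hcδ : IsSmoothPeriodic L (cylDeriv (lerayPart hL hu₁) δu) := isSmoothPeriodic_cylDeriv hw₁ hδus
  have hcw : IsSmoothPeriodic L (cylDeriv δw (fromTorus L U₂)) := isSmoothPeriodic_cylDeriv hδws hu₂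
  have hY : cellOf L (klOp L hL h₁) - cellOf L (klOp L hL h₂) =
      toCell L (cylDeriv (lerayPart hL hu₁) δu) + toCell L (cylDeriv δw (fromTorus L U₂)) -
        (toCell L (pressureGrad hL hu₁) - toCell L (pressureGrad hL hu₂)) := by
    rw [hA h₁, hA h₂, toCell_sub hc₁.memLp hπ₁.memLp, toCell_sub hc₂.memLp hπ₂.memLp]
    have hlin : toCell L (cylDeriv (lerayPart hL hu₁) (fromTorus L U₁)) - toCell L (cylDeriv (lerayPart hL hu₂) (fromTorus L U₂)) =
        toCell L (cylDeriv (lerayPart hL hu₁) δu) + toCell L (cylDeriv δw (fromTorus L U₂)) := by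
      rw [← toCell_sub hc₁.memLp hc₂.memLp, ← toCell_add hcδ.memLp hcw.memLp]
      refine toCell_congr fun x hx => ?_
      have hxK : x ∈ 𝕂 := hcell hx
      rw [hδw, cylDeriv_field_sub, hδu, cylDeriv_sub hu₁.smooth hu₂.smooth hxK]
      abel
    rw [← hlin]
    abel
  rw [hX, hY, inner_sub_right, inner_add_right, hT3,
    inner_toCell_toCell hδus.memLp hcδ.memLp, hT1, zero_add]
  have hB2 : |⟪toCell L δu, toCell L (cylDeriv δw (fromTorus L U₂))⟫_ℝ| ≤ K * Real.sqrt (Torus.latNormSq 3 U₂) * ‖toCell L δu‖ ^ 2 := by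
    calc _ ≤ ‖toCell L δu‖ * ‖toCell L (cylDeriv δw (fromTorus L U₂))‖ := abs_real_inner_le_norm _ _
      _ ≤ ‖toCell L δu‖ * (K * Real.sqrt (Torus.latNormSq 3 U₂) * ‖toCell L δu‖) := mul_le_mul_of_nonneg_left hT2le (norm_nonneg _)
      _ = _ := by ring
  have hB3 : |⟪helmholtzProj L (toCell L δu), toCell L (convTerm hL hu₁) - toCell L (convTerm hL hu₂)⟫_ℝ| ≤
      ‖helmholtzProj L (toCell L δu)‖ * ‖toCell L (convTerm hL hu₁) - toCell L (convTerm hL hu₂)‖ := abs_real_inner_le_norm _ _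
  calc _ ≤ |⟪toCell L δu, toCell L (cylDeriv δw (fromTorus L U₂))⟫_ℝ| +
        |⟪helmholtzProj L (toCell L δu), toCell L (convTerm hL hu₁) - toCell L (convTerm hL hu₂)⟫_ℝ| := abs_sub _ _
    _ ≤ _ := add_le_add hB2 hB3

/-- **The convective term `b = (w·∇_K) w` is bounded in `L²(cell)`** on `lat₂`-balls:
`‖toCell b‖ ≤ C lat₂(U)`. [folklore] -/
theorem exists_norm_toCell_convTerm_le : ∃ C : ℝ, 0 ≤ C ∧
    ∀ (U : UnitAddTorus (Fin 3) → ℝ³) (hU : IsSmooth U),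
      ‖toCell L (convTerm hL (isSmoothPeriodic_fromTorus hL.ne' hU))‖ ≤ C * Torus.latNormSq 2 U := by
  obtain ⟨Csl, hCsl0, hCsl⟩ := exists_integral_convect_sq_le_sup_left
  obtain ⟨CW, hCW0, hCW⟩ := exists_latNormSq_transportRep_le hL (m := 2) (by norm_num)
  obtain ⟨K₂, hK₂0, hK₂⟩ := exists_latNormSq_two_rep_lerayPart_le hL
  refine ⟨Real.sqrt (16 * L * Csl * CW * K₂), by positivity, fun U hU => ?_⟩
  have hu := isSmoothPeriodic_fromTorus hL.ne' hU
  have hw := isSmoothPeriodic_lerayPart hL hu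
  have hb := isSmoothPeriodic_convTerm hL hu
  set A := transportRep L hL hU with hAdef
  set B := torusRep L (lerayPart hL hu) with hBdef
  have hAs : IsSmooth A := isSmooth_transportRep hL hU
  have hBs : IsSmooth B := isSmooth_torusRep hw
  have hcell : toCell L (convTerm hL hu) = cellOf L (Torus.convect A B) := by
    refine toCell_congr fun x hx => ?_
    exact cylDeriv_eq_fromTorus_convect hL hw hw (cylinderCell_le_unitCylinder L hx)
  have l2 := Torus.latNormSq_nonneg 2 U
  have hsq : ‖toCell L (convTerm hL hu)‖ ^ 2 ≤ (Real.sqrt (16 * L * Csl * CW * K₂) * Torus.latNormSq 2 U) ^ 2 := by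
    rw [hcell, norm_cellOf_sq (hAs.convect hBs), mul_pow, Real.sq_sqrt (by positivity)]
    have h1 := integral_cylinderCell_fromTorus_sq_le hL (hAs.convect hBs)
    have h2 := hCsl A B hAs hBs
    have h3 : Torus.latNormSq 2 A ≤ CW * Torus.latNormSq 2 U := hCW U hU
    have h4 : Torus.latNormSq 1 B ≤ K₂ * Torus.latNormSq 2 U :=
      (Torus.latNormSq_mono hBs (by norm_num)).trans (hK₂ U hU)
    calc ∫ x in (cylinderCell L : Set ℝ³), ‖fromTorus L (Torus.convect A B) x‖ ^ 2
        ≤ 16 * L * ∫ ξ, ‖Torus.convect A B ξ‖ ^ 2 := h1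
      _ ≤ 16 * L * (Csl * Torus.latNormSq 2 A * Torus.latNormSq 1 B) := mul_le_mul_of_nonneg_left h2 (by positivity)
      _ ≤ 16 * L * (Csl * (CW * Torus.latNormSq 2 U) * (K₂ * Torus.latNormSq 2 U)) :=
          mul_le_mul_of_nonneg_left (mul_le_mul (mul_le_mul_of_nonneg_left h3 hCsl0) h4 (Torus.latNormSq_nonneg 1 B) (by positivity))
            (by positivity)
      _ = _ := by ring
  exact (pow_le_pow_iff_left₀ (norm_nonneg _) (by positivity) two_ne_zero).1 hsq

/-! ### The estimate in the limit and uniqueness -/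

section Sol

variable {s₁ s₂ : ℕ} {ε₁ ε₂ : ℝ} {φ₁ φ₂ : SymL2 (Fin 3)} {T₁ T₂ : ℝ} {u₁ u₂ : ℝ → SymL2 (Fin 3)}

/-- **The energy estimate for the difference**: if `Q (R(i u₁(t)) − R(i u₂(t))) = 0` then
`|⟪R(i u₁) − R(i u₂), R 𝒜̂₁u₁ − R 𝒜̂₂u₂⟫| ≤ K' ‖R(i u₁) − R(i u₂)‖²`, with `K'` depending on a bound
of `‖u₂(t)‖`. [cite: KatoLai1984, §5 (p. 23)] -/
theorem exists_abs_inner_velCell_sub_le (ρ : ℝ) : ∃ K' : ℝ, 0 ≤ K' ∧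
    ∀ (s₁ s₂ : ℕ) (ε₁ ε₂ : ℝ) (f₁ f₂ : SymL2 (Fin 3)), ‖f₂‖ ≤ ρ →
      helmholtzProj L (cellRestrict hL (embed s₁ ε₁ f₁) - cellRestrict hL (embed s₂ ε₂ f₂)) = 0 →
      |⟪cellRestrict hL (embed s₁ ε₁ f₁) - cellRestrict hL (embed s₂ ε₂ f₂),
          cellRestrict hL (klOpExt hL s₁ ε₁ f₁) - cellRestrict hL (klOpExt hL s₂ ε₂ f₂)⟫_ℝ| ≤
        K' * ‖cellRestrict hL (embed s₁ ε₁ f₁) - cellRestrict hL (embed s₂ ε₂ f₂)‖ ^ 2 := by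
  obtain ⟨K, hK0, hK⟩ := exists_abs_inner_cellOf_sub_klOp_sub_le hL
  obtain ⟨Cb, hCb0, hCb⟩ := exists_norm_toCell_convTerm_le hL
  refine ⟨K * (4 * |ρ|), by positivity, fun s₁ s₂ ε₁ ε₂ f₁ f₂ hf₂ hQ => ?_⟩
  -- the truncations
  set x : ℕ → Lp ℝ³ 2 (cellMeasure L) := fun N => cellOf L (truncField s₁ ε₁ N f₁) - cellOf L (truncField s₂ ε₂ N f₂) with hx
  set y : ℕ → Lp ℝ³ 2 (cellMeasure L) := fun N =>
    cellOf L (klOp L hL (isSmooth_truncField s₁ ε₁ N f₁)) - cellOf L (klOp L hL (isSmooth_truncField s₂ ε₂ N f₂)) with hy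
  set D := cellRestrict hL (embed s₁ ε₁ f₁) - cellRestrict hL (embed s₂ ε₂ f₂) with hD
  have hxD : Tendsto x atTop (𝓝 D) := (tendsto_cellOf_truncField hL s₁ ε₁ f₁).sub (tendsto_cellOf_truncField hL s₂ ε₂ f₂)
  have hyA : Tendsto y atTop (𝓝 (cellRestrict hL (klOpExt hL s₁ ε₁ f₁) - cellRestrict hL (klOpExt hL s₂ ε₂ f₂))) :=
    (tendsto_cellOf_klOp_truncField hL s₁ ε₁ f₁).sub (tendsto_cellOf_klOp_truncField hL s₂ ε₂ f₂)
  have hinner := (Filter.Tendsto.inner (𝕜 := ℝ) hxD hyA).abs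
  -- the per-truncation bound
  have hρ : 0 ≤ |ρ| := abs_nonneg ρ
  have h3 : ∀ N, Real.sqrt (Torus.latNormSq 3 (truncField s₂ ε₂ N f₂)) ≤ 4 * |ρ| := fun N => by
    have h := latNormSq_three_truncField_le s₂ ε₂ N f₂
    have h' : Torus.latNormSq 3 (truncField s₂ ε₂ N f₂) ≤ (4 * |ρ|) ^ 2 := by
      calc _ ≤ 16 * ‖f₂‖ ^ 2 := h
        _ ≤ 16 * ρ ^ 2 := mul_le_mul_of_nonneg_left (pow_le_pow_left₀ (norm_nonneg _) hf₂ 2) (by norm_num)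
        _ = (4 * |ρ|) ^ 2 := by rw [mul_pow, sq_abs]; norm_num
    calc Real.sqrt (Torus.latNormSq 3 (truncField s₂ ε₂ N f₂)) ≤ Real.sqrt ((4 * |ρ|) ^ 2) := Real.sqrt_le_sqrt h'
      _ = 4 * |ρ| := Real.sqrt_sq (by positivity)
  have hb : ∀ N, ‖toCell L (convTerm hL (isSmoothPeriodic_fromTorus hL.ne' (isSmooth_truncField s₁ ε₁ N f₁))) -
      toCell L (convTerm hL (isSmoothPeriodic_fromTorus hL.ne' (isSmooth_truncField s₂ ε₂ N f₂)))‖ ≤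
      Cb * (16 * ‖f₁‖ ^ 2) + Cb * (16 * ‖f₂‖ ^ 2) := fun N => by
    refine (norm_sub_le _ _).trans (add_le_add ?_ ?_)
    · refine (hCb _ (isSmooth_truncField s₁ ε₁ N f₁)).trans (mul_le_mul_of_nonneg_left ?_ hCb0)
      exact ((Torus.latNormSq_mono (isSmooth_truncField s₁ ε₁ N f₁) (by norm_num)).trans (latNormSq_three_truncField_le s₁ ε₁ N f₁))
    · refine (hCb _ (isSmooth_truncField s₂ ε₂ N f₂)).trans (mul_le_mul_of_nonneg_left ?_ hCb0)
      exact ((Torus.latNormSq_mono (isSmooth_truncField s₂ ε₂ N f₂) (by norm_num)).trans (latNormSq_three_truncField_le s₂ ε₂ N f₂))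
  set Bb : ℝ := Cb * (16 * ‖f₁‖ ^ 2) + Cb * (16 * ‖f₂‖ ^ 2) with hBb
  have hper : ∀ N, |⟪x N, y N⟫_ℝ| ≤ K * (4 * |ρ|) * ‖x N‖ ^ 2 + ‖helmholtzProj L (x N)‖ * Bb := fun N => by
    have h := hK _ _ (isSmooth_truncField s₁ ε₁ N f₁) (isSmooth_truncField s₂ ε₂ N f₂)
    refine h.trans (add_le_add ?_ ?_)
    · exact mul_le_mul_of_nonneg_right (mul_le_mul_of_nonneg_left (h3 N) hK0) (sq_nonneg _)
    · exact mul_le_mul_of_nonneg_left (hb N) (norm_nonneg _)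
  -- pass to the limit: `Q (x N) → Q D = 0`
  have hQx : Tendsto (fun N => ‖helmholtzProj L (x N)‖ * Bb) atTop (𝓝 0) := by
    have h := (((helmholtzProj L).continuous.tendsto _).comp hxD).norm.mul_const Bb
    rw [show ‖helmholtzProj L D‖ * Bb = 0 by rw [hQ, norm_zero, zero_mul]] at h
    exact h
  have hrhs : Tendsto (fun N => K * (4 * |ρ|) * ‖x N‖ ^ 2 + ‖helmholtzProj L (x N)‖ * Bb) atTop (𝓝 (K * (4 * |ρ|) * ‖D‖ ^ 2 + 0)) :=
    ((hxD.norm.pow 2).const_mul _).add hQx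
  rw [add_zero] at hrhs
  exact le_of_tendsto_of_tendsto' hinner hrhs hper

/-- **Uniqueness of the cell velocity** (Kato–Lai p. 23, by Grönwall): two solutions in duality
form on `[0, T]` with the same cell velocity class at `t = 0` and vanishing gradient parts have
the same cell velocity class on `[0, T]`. [cite: KatoLai1984, §5 (p. 23)] -/
theorem velCell_eq_of_eq_zero (hu₁ : KatoLai.IsFormSolution (embed s₁ ε₁) (klForm hL s₁ ε₁) φ₁ T₁ u₁)
    (hu₂ : KatoLai.IsFormSolution (embed s₂ ε₂) (klForm hL s₂ ε₂) φ₂ T₂ u₂) {T : ℝ} (hT : 0 ≤ T) (hT₁ : T ≤ T₁) (hT₂ : T ≤ T₂)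
    (hQ₁ : ∀ t ∈ Icc 0 T, helmholtzProj L (velCell hL s₁ ε₁ u₁ t) = 0)
    (hQ₂ : ∀ t ∈ Icc 0 T, helmholtzProj L (velCell hL s₂ ε₂ u₂ t) = 0)
    (h0 : velCell hL s₁ ε₁ u₁ 0 = velCell hL s₂ ε₂ u₂ 0) :
    ∀ t ∈ Icc 0 T, velCell hL s₁ ε₁ u₁ t = velCell hL s₂ ε₂ u₂ t := by
  -- a bound of `‖u₂ t‖` on `[0, T₂]` from weak continuity
  obtain ⟨ρ, hρ⟩ : ∃ ρ : ℝ, ∀ t ∈ Icc 0 T, ‖u₂ t‖ ≤ ρ := by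
    -- `t ↦ ‖u₂ t‖²` need not be continuous, but `u₂` is weakly continuous hence bounded on the compact interval:
    -- use the uniform boundedness principle through `SymL2.WeakTendsto.exists_norm_le` along sequences? Simpler:
    -- the energy bound is not available here, so we argue by Banach–Steinhaus on the family `(u₂ t)`.
    have hpt : ∀ h : SymL2 (Fin 3), ∃ C, ∀ t : Icc 0 T, ‖(innerSL ℝ (u₂ t.1)) h‖ ≤ C := fun h => by
      have hc : ContinuousOn (fun t => ⟪h, u₂ t⟫_ℝ) (Icc 0 T) := (hu₂.continuousOn_inner h).mono (Icc_subset_Icc le_rfl hT₂)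
      obtain ⟨C, hC⟩ := (isCompact_Icc (a := (0:ℝ)) (b := T)).exists_bound_of_continuousOn hc
      refine ⟨C, fun t => ?_⟩
      rw [innerSL_apply_apply, real_inner_comm]
      exact hC t.1 t.2
    obtain ⟨C, hC⟩ := banach_steinhaus (g := fun t : Icc 0 T => innerSL ℝ (u₂ t.1)) hpt
    refine ⟨C, fun t ht => ?_⟩
    have := hC ⟨t, ht⟩
    rwa [innerSL_apply_norm] at this
  obtain ⟨K', hK'0, hK'⟩ := exists_abs_inner_velCell_sub_le hL ρ
  set D : ℝ → Lp ℝ³ 2 (cellMeasure L) := fun t => velCell hL s₁ ε₁ u₁ t - velCell hL s₂ ε₂ u₂ t with hD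
  set F : ℝ → ℝ := fun t => ⟪D t, D t⟫_ℝ with hF
  have hT₁' : 0 ≤ T₁ := hT.trans hT₁
  have hT₂' : 0 ≤ T₂ := hT.trans hT₂
  have hDd : ∀ t ∈ Icc 0 T, HasDerivWithinAt D
      (-(cellRestrict hL (klOpExt hL s₁ ε₁ (u₁ t)) - cellRestrict hL (klOpExt hL s₂ ε₂ (u₂ t)))) (Icc 0 T) t := by
    intro t ht
    have h1 := (hasDerivWithinAt_velCell hL s₁ ε₁ hu₁ hT₁' ⟨ht.1, ht.2.trans hT₁⟩).mono (Icc_subset_Icc le_rfl hT₁)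
    have h2 := (hasDerivWithinAt_velCell hL s₂ ε₂ hu₂ hT₂' ⟨ht.1, ht.2.trans hT₂⟩).mono (Icc_subset_Icc le_rfl hT₂)
    have h := h1.sub h2
    have e : -(cellRestrict hL (klOpExt hL s₁ ε₁ (u₁ t)) - cellRestrict hL (klOpExt hL s₂ ε₂ (u₂ t))) =
        -cellRestrict hL (klOpExt hL s₁ ε₁ (u₁ t)) - -cellRestrict hL (klOpExt hL s₂ ε₂ (u₂ t)) := by abel
    rw [e]
    exact h
  have hFd : ∀ t ∈ Icc 0 T, HasDerivWithinAt F
      (-(2 * ⟪D t, cellRestrict hL (klOpExt hL s₁ ε₁ (u₁ t)) - cellRestrict hL (klOpExt hL s₂ ε₂ (u₂ t))⟫_ℝ)) (Icc 0 T) t := by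
    intro t ht
    have h := (hDd t ht).inner (𝕜 := ℝ) (hDd t ht)
    refine h.congr_deriv ?_
    rw [inner_neg_right, inner_neg_left, real_inner_comm (D t)]
    ring
  have hFc : ContinuousOn F (Icc 0 T) := fun t ht => (hFd t ht).continuousWithinAt
  have hFd' : ∀ x ∈ Ico 0 T, HasDerivWithinAt F
      (-(2 * ⟪D x, cellRestrict hL (klOpExt hL s₁ ε₁ (u₁ x)) - cellRestrict hL (klOpExt hL s₂ ε₂ (u₂ x))⟫_ℝ)) (Ici x) x := fun x hx =>
    (hFd x ⟨hx.1, hx.2.le⟩).mono_of_mem_nhdsWithin (mem_of_superset (Icc_mem_nhdsGE hx.2) (Icc_subset_Icc hx.1 le_rfl))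
  have hF0 : ‖F 0‖ ≤ 0 := by
    have : D 0 = 0 := by simp [hD, h0]
    simp [hF, this]
  have hbound : ∀ x ∈ Ico 0 T, ‖-(2 * ⟪D x, cellRestrict hL (klOpExt hL s₁ ε₁ (u₁ x)) - cellRestrict hL (klOpExt hL s₂ ε₂ (u₂ x))⟫_ℝ)‖ ≤
      2 * K' * ‖F x‖ + 0 := by
    intro x hx
    have hxI : x ∈ Icc 0 T := ⟨hx.1, hx.2.le⟩
    have hQD : helmholtzProj L (D x) = 0 := by
      simp only [hD, map_sub, hQ₁ x hxI, hQ₂ x hxI, sub_zero]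
    have h := hK' s₁ s₂ ε₁ ε₂ (u₁ x) (u₂ x) (hρ x hxI) hQD
    have hFx : ‖F x‖ = ‖D x‖ ^ 2 := by
      rw [hF]; simp only; rw [real_inner_self_eq_norm_sq, Real.norm_of_nonneg (sq_nonneg _)]
    rw [add_zero, hFx, norm_neg, Real.norm_eq_abs, abs_mul, abs_two]
    have : |⟪D x, cellRestrict hL (klOpExt hL s₁ ε₁ (u₁ x)) - cellRestrict hL (klOpExt hL s₂ ε₂ (u₂ x))⟫_ℝ| ≤ K' * ‖D x‖ ^ 2 := h
    nlinarith
  intro t ht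
  have hG := norm_le_gronwallBound_of_norm_deriv_right_le hFc hFd' hF0 hbound t ht
  rw [gronwallBound_ε0_δ0] at hG
  have hF0' : F t = 0 := by
    have := norm_nonneg (F t)
    exact norm_eq_zero.1 (le_antisymm hG this)
  have : D t = 0 := inner_self_eq_zero.1 hF0'
  exact sub_eq_zero.1 this

end Sol

end PeriodicCylinder

end Literature.Analysis.FluidPDE
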